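import Literature.MathematicalPhysics.QuantumLattice.BalabanRG
import Literature.MathematicalPhysics.QuantumLattice.BalabanBlockAverage
import HarnessLib

/-!
# Bałaban's covariant block averaging `U ↦ Ū` on `ℤ^d` and its iterates (CMP 98 (1985) (42)–(43))

Topic `Literature/MathematicalPhysics/QuantumLattice` (definition item `defn-BalabanBlockAverage` of the YM
cell, crux `stmt-QuantumFields-19354`: "every block-currency statement … needs UV-STABLE block variables at
fixed physical side; the tree's one-step thin axial line … iterating the axial line alone composes to a thin
line again; Bałaban's (42) has the transverse block sum at every step"). DEFINITIONS WITH BODIES and proved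
API; no named fact, no `sorry`, no instance, no notation.

The tree already holds Bałaban's one-step average on the DISCRETE TORUS, with the analytic core factored out:
`Literature/MathematicalPhysics/QuantumLattice/BalabanBlockAverage.lean` (item `defn-balabanBlockAverage` of
crux 9366) defines the matrix mean (42) `balabanMatrixMean ρ S T = exp((#ι)⁻¹ ∑ᵢ log ρ(Tᵢ S⁻¹)) ρ(S)` and the
`G`-valued total extension `balabanGroupMean ρ S T` (Bałaban's branch when the family is small and the mean
lies in `ρ(G)`, the reference `S` otherwise — see that file's "TOTALITY" discussion), with conjugation
equivariance `balabanGroupMean_conj`, joint measurability `measurable_balabanGroupMean` and the linearisation,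
and instantiates it on `GaugeConfig d (M L') G → GaugeConfig d L' G`. THIS file instantiates the SAME mean in
the `ℤ^d` vocabulary of `BalabanRG.lean` (`Site d`, `ZdEdge d`, `LGConfig d G`, `blockBase`, `blockMap`,
`blockLine`, `axialBlockHolonomy`, `gaugeTransformZd`), where the coarse lattice `L ℤ^d` is re-identified with
`ℤ^d` after each step, so that the `k`-th order averaging (43) is literally the `k`-fold ITERATE — which the
torus version cannot express without a tower of tori — and proves the four properties the request asks for.

## Source (T. Bałaban, *Averaging operations for lattice gauge theories*, CMP 98 (1985) 17–51
## [Balaban1985Averaging]; held text `paper:balaban1985-cmp98-averaging`, PDF p. 3 (p. 19), pp. 7–8 (pp. 23–24))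

(11) *"the averaging preserves gauge transformations, `Ū^u(c) = u(c₋) Ū(c) u⁻¹(c₊)`"*; p. 19: *"`Γ_{c₋,x} ∪
[x, x(c)] ∪ Γ_{x(c),c₊}` is an oriented contour with `c₋` as an initial point and `c₊` as a final point. We denote
it by `Γ_{c,x}`"* (the `Γ_{y,x}` being the fixed contours inside blocks of [Balaban1984Propagators, (1.8)]);
(15) = Sect. B (42): *"The one-step averaging operation is defined by
`Ū_c = exp[ i ∑_{x ∈ B(c₋)} L^{-d} (1/i) log( U(Γ_{c,x}) U(c)⁻¹ ) ] U(c)`"*; (43): *"and if `k`-th order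
averaging `U^k` is defined at bonds of `Ω^{(k)}`, then `U^{k+1}_c = exp[ i ∑_{x ∈ B(c₋)} L^{-d} (1/i)
log( U^k(Γ_{c,x}) U^k(c)⁻¹ ) ] U^k(c)`, where the contours `Γ_{c,x}` are defined on the lattice `Ω^{(k)}`"*;
p. 24: *"this definition is local in the sense that `U^k_c`, `c ⊂ Ω^{(k)}`, depends only on the bond variables
`U_b` for `b ⊂ B^k(c₋) ∪ B^k(c₊)`. … the property (11) is satisfied. Indeed … `U^u(Γ_{c,x}) U^u(c)⁻¹ =
u(c₋) U(Γ_{c,x}) U(c)⁻¹ u⁻¹(c₋)`, thus … their logarithms are unitarily equivalent with the same unitary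
operator `u(c₋)`. Then from (42) we get `(Ū^u)_c = u(c₋) Ū_c u⁻¹(c₊)`"*.

## Contents (block factor `L`, coarse bond `c = (y, μ)`, `c₋ = L y = blockBase L y`, `c₊ = L (y + e_μ)`)

* Paths of unit positive steps in `ℤ^d`: `pathEndZd x is` (endpoint), `pathEdgesZd x is` (its bonds),
  `pathHolonomyZd U x is` (ordered product of the link variables — parallel transport), the coordinate-ordered
  taxi word `taxiWord t` of an offset `t` (Bałaban's `Γ_{y,x}` inside a block, as the torus file's
  `torusBlockPath`), with `pathHolonomyZd_append`, `pathHolonomyZd_replicate(_blockBase)` (the straight segment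
  of `L` steps from the block corner IS the tree's `axialBlockHolonomy`), `pathEndZd_taxiWord/_replicate`,
  `pathHolonomyZd_congr` (locality), `bounds_of_mem_pathEdgesZd` (a path stays in the box spanned by its
  endpoints) and the telescoping GAUGE COVARIANCE `pathHolonomyZd_gaugeTransformZd`.
* `dressedTransporterZd L U c t = U(Γ_{c,x})`, `x = c₋ + t`, `t ∈ {0,…,L-1}^d`: taxi path `c₋ → x`, straight
  segment `x → x + L e_μ`, inverse of the taxi path `c₊ → x + L e_μ` (same pattern started at the corner of the
  neighbouring block); `dressedTransporterZd_gaugeTransformZd` (conjugation by `u(c₋)`, `u(c₊)`),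
  `dressedTransporterZd_one`.
* **`balabanAverageZd L ρ U c := balabanGroupMean ρ (axialBlockHolonomy L U c) (dressedTransporterZd L U c)`** —
  (42) with reference `U(c) =` the straight line and the family of the `L^d` dressed transporters — and
  **`balabanAverageZdIter L ρ k := (balabanAverageZd L ρ)^[k]`** — (43).
* The requested properties: GAUGE COVARIANCE `balabanAverageZd_gaugeTransformZd`
  (`Ū(U^g) = (Ū U)^{g ∘ blockBase L}`, the law of the tree's `axialBlockHolonomy_gaugeTransformZd`) and
  `balabanAverageZdIter_gaugeTransformZd` (`g ∘ blockBase (L^k)`); MEASURABILITY `measurable_balabanAverageZd`,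
  `measurable_balabanAverageZdIter` (compact `G`, continuous faithful unitary `ρ`, product Borel structures);
  LOCALITY in Bałaban's sharp form — `doubleBlockBonds L c` = the bonds with BOTH endpoints in
  `B(c₋) ∪ B(c₊)` ("`b ⊂ B(c₋) ∪ B(c₊)`"): `dependsOn_balabanAverageZd_apply` and, by induction with
  `blockMap_blockMap` (`⌊⌊x/M⌋/M'⌋ = ⌊x/(M M')⌋`), `dependsOn_balabanAverageZdIter_apply` (`B^k`-blocks of side
  `L^k`); REDUCTION `balabanAverageZd_apply_eq_axialBlockHolonomy` (if every dressed transporter at `c` equals the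
  straight one, `Ū(c)` is the axial block holonomy — `balabanGroupMean_const`), `balabanAverageZd_one`,
  `balabanAverageZdIter_one`.

## Design notes

* Same conventions as `BalabanRG.lean`: blocks labelled by corners `L y` (Bałaban centres them), no rescaling,
  `LGConfig d G → LGConfig d G`. The total extension off the small-field region and the threshold `1/2` are those
  of `balabanGroupMean` (documented there); Bałaban uses `Ū` only on small/regular fields (p. 42).
* `G` any group with a representation `ρ : G →* M_N(ℂ)`; covariance needs `ρ` unitary and faithful
  (`balabanGroupMean_conj`), measurability needs `G` compact with continuous faithful `ρ` — hypotheses, not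
  instances, as in the torus file.
* NOT here: the regularity/analyticity estimates of Sects. B–E, the averaging of gauge transformations
  (Sect. F), the axial-gauge variants (Sect. C), the linearisation (14) (proved for the same mean in the torus
  file, `hasDerivAt_balabanMatrixMean`), and the RG recursion of `BlockRGScheme` (still `STUB(v0)` there).
-/

noncomputable section

open scoped Matrix.Norms.L2Operator
open MeasureTheory Finset
open Literature.Probability.LatticeModels Literature.Analysis.Complex

namespace Literature.MathematicalPhysics.QuantumLattice

variable {d : ℕ} {G : Type*}

/-! ### Path holonomies on `ℤ^d` -/

section Path

/-- The endpoint `x + ∑ₖ e_{iₖ}` of the lattice path starting at `x` with unit positive steps in the directions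
`is` (Bałaban 1984, §1: contours `Γ` made of bonds of the lattice). [folklore] -/
def pathEndZd : Site d → List (Fin d) → Site d
  | x, [] => x
  | x, i :: is => pathEndZd (x + Pi.single i 1) is

/-- The (positively oriented) bonds of the lattice path from `x` with steps `is`. [folklore] -/
def pathEdgesZd : Site d → List (Fin d) → List (ZdEdge d)
  | _, [] => []
  | x, i :: is => (x, i) :: pathEdgesZd (x + Pi.single i 1) is

variable [Monoid G] in
/-- **Parallel transport `U(Γ)`** along the path from `x` with unit positive steps `is`: the ordered product of
the link variables (Bałaban 1985, p. 19: `U(Γ_{c,x})`; Bałaban 1984, (1.5)). [folklore] -/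
def pathHolonomyZd (U : LGConfig d G) : Site d → List (Fin d) → G
  | _, [] => 1
  | x, i :: is => U (x, i) * pathHolonomyZd U (x + Pi.single i 1) is

/-- The empty path ends where it starts. [cite: Balaban1985Averaging, Intro p. 19 (contours Γ_{c,x})] -/
@[simp] theorem pathEndZd_nil (x : Site d) : pathEndZd x [] = x := rfl

/-- Endpoint of a path, one step at a time. [cite: Balaban1985Averaging, Intro p. 19 (contours Γ_{c,x})] -/
@[simp] theorem pathEndZd_cons (x : Site d) (i : Fin d) (is : List (Fin d)) :
    pathEndZd x (i :: is) = pathEndZd (x + Pi.single i 1) is := rfl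
/-- The empty path has no bonds. [cite: Balaban1985Averaging, Intro p. 19 (contours Γ_{c,x})] -/
@[simp] theorem pathEdgesZd_nil (x : Site d) : pathEdgesZd x [] = [] := rfl

/-- Bonds of a path, one step at a time. [cite: Balaban1985Averaging, Intro p. 19 (contours Γ_{c,x})] -/
@[simp] theorem pathEdgesZd_cons (x : Site d) (i : Fin d) (is : List (Fin d)) :
    pathEdgesZd x (i :: is) = (x, i) :: pathEdgesZd (x + Pi.single i 1) is := rfl

section Mon
variable [Monoid G]
/-- Transport along the empty path is `1`. [cite: Balaban1985Averaging, Intro p. 19 (U(Γ_{c,x}))] -/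
@[simp] theorem pathHolonomyZd_nil (U : LGConfig d G) (x : Site d) : pathHolonomyZd U x [] = 1 := rfl

/-- Transport along a path, one bond at a time. [cite: Balaban1985Averaging, Intro p. 19 (U(Γ_{c,x}))] -/
@[simp] theorem pathHolonomyZd_cons (U : LGConfig d G) (x : Site d) (i : Fin d) (is : List (Fin d)) :
    pathHolonomyZd U x (i :: is) = U (x, i) * pathHolonomyZd U (x + Pi.single i 1) is := rfl

/-- The endpoint of a concatenated path. [cite: Balaban1985Averaging, Intro p. 19 (Γ_{c,x} = Γ_{c₋,x} ∪ [x,x(c)] ∪ Γ_{x(c),c₊})] -/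
theorem pathEndZd_append (x : Site d) (is js : List (Fin d)) :
    pathEndZd x (is ++ js) = pathEndZd (pathEndZd x is) js := by
  induction is generalizing x with
  | nil => rfl
  | cons i is ih => exact ih _

/-- **Transport is multiplicative under concatenation**: `U(Γ ∪ Γ') = U(Γ) U(Γ')` (Bałaban 1985, p. 19: the
contour `Γ_{c,x}` is the union of three pieces). [cite: Balaban1985Averaging, Intro p. 19 (Γ_{c,x} = Γ_{c₋,x} ∪ [x,x(c)] ∪ Γ_{x(c),c₊})] -/
theorem pathHolonomyZd_append (U : LGConfig d G) (x : Site d) (is js : List (Fin d)) :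
    pathHolonomyZd U x (is ++ js) = pathHolonomyZd U x is * pathHolonomyZd U (pathEndZd x is) js := by
  induction is generalizing x with
  | nil => simp
  | cons i is ih => rw [List.cons_append, pathHolonomyZd_cons, pathHolonomyZd_cons, ih, mul_assoc]; rfl

/-- The straight segment of `n` steps in direction `μ` ends at `x + n e_μ` (`x(c) = x + L e_μ`).
[cite: Balaban1985Averaging, Intro p. 19 ([x, x(c)])] -/
theorem pathEndZd_replicate (x : Site d) (μ : Fin d) (n : ℕ) :
    pathEndZd x (List.replicate n μ) = x + Pi.single μ (n : ℤ) := by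
  induction n generalizing x with
  | zero => simp
  | succ n ih =>
    rw [List.replicate_succ, pathEndZd_cons, ih, add_assoc, ← Pi.single_add, Nat.cast_succ, add_comm (1 : ℤ)]

/-- Transport along a straight segment as an ordered product over its bonds (Bałaban 1984, (1.5)).
[cite: Balaban1984Propagators, §1 (1.5)] -/
theorem pathHolonomyZd_replicate (U : LGConfig d G) (x : Site d) (μ : Fin d) (n : ℕ) :
    pathHolonomyZd U x (List.replicate n μ) =
      ((List.range n).map fun t : ℕ => U (x + Pi.single μ (t : ℤ), μ)).prod := by
  induction n generalizing x with
  | zero => simp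
  | succ n ih =>
    rw [List.replicate_succ, pathHolonomyZd_cons, ih, List.range_succ_eq_map, List.map_cons, List.map_map,
      List.prod_cons]
    congr 1
    · simp
    · congr 1
      refine List.map_congr_left fun t _ ↦ ?_
      simp only [Function.comp_apply, Nat.cast_succ, add_assoc, ← Pi.single_add, add_comm (1 : ℤ)]

/-- **The straight segment of `M` steps from the block corner is the tree's axial block holonomy**
`axialBlockHolonomy M U b` (`BalabanRG.lean`; Bałaban 1984, (1.4)–(1.6): the straight contour between block
corners = Bałaban 1985's `U(c)`). [cite: Balaban1984Propagators, §1 (1.4)–(1.6)] -/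
theorem pathHolonomyZd_replicate_blockBase (M : ℕ) (U : LGConfig d G) (b : ZdEdge d) :
    pathHolonomyZd U (blockBase M b.1) (List.replicate M b.2) = axialBlockHolonomy M U b := by
  rw [pathHolonomyZd_replicate, axialBlockHolonomy, blockLine, List.map_map]
  rfl

/-- Transport of the trivial configuration is trivial. [cite: Balaban1985Averaging, Intro p. 19 (U(Γ_{c,x}))] -/
theorem pathHolonomyZd_one (x : Site d) (is : List (Fin d)) : pathHolonomyZd (1 : LGConfig d G) x is = 1 := by
  induction is generalizing x with
  | nil => rfl
  | cons i is ih => rw [pathHolonomyZd_cons, ih]; simp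

/-- **Locality of transport**: `U(Γ)` depends only on the link variables on the bonds of `Γ`.
[cite: Balaban1985Averaging, Sect. B p. 24 (locality)] -/
theorem pathHolonomyZd_congr {U V : LGConfig d G} (x : Site d) (is : List (Fin d))
    (h : ∀ e ∈ pathEdgesZd x is, U e = V e) : pathHolonomyZd U x is = pathHolonomyZd V x is := by
  induction is generalizing x with
  | nil => rfl
  | cons i is ih =>
    rw [pathHolonomyZd_cons, pathHolonomyZd_cons, h _ (by simp), ih _ fun e he ↦ h e (by simp [he])]

/-- A path of positive steps does not decrease any coordinate. [cite: Balaban1985Averaging, Sect. B p. 24 (locality)] -/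
theorem le_pathEndZd (x : Site d) (is : List (Fin d)) (j : Fin d) : x j ≤ pathEndZd x is j := by
  induction is generalizing x with
  | nil => exact le_rfl
  | cons i is ih =>
    refine le_trans ?_ (ih _)
    by_cases hj : j = i
    · subst hj; simp
    · simp [hj]

/-- **Box bounds**: every bond of a path of unit positive steps has its base point in the coordinate box between
the start and the end of the path, strictly below the end in its own direction (so both its endpoints lie in the
box) — the combinatorial content of Bałaban's locality remark (p. 24). [cite: Balaban1985Averaging, Sect. B p. 24 (locality)] -/
theorem bounds_of_mem_pathEdgesZd {x : Site d} {is : List (Fin d)} {e : ZdEdge d} (he : e ∈ pathEdgesZd x is) :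
    (∀ j, x j ≤ e.1 j ∧ e.1 j ≤ pathEndZd x is j) ∧ e.1 e.2 + 1 ≤ pathEndZd x is e.2 := by
  induction is generalizing x with
  | nil => simp at he
  | cons i is ih =>
    rw [pathEdgesZd_cons, List.mem_cons] at he
    rcases he with rfl | he
    · refine ⟨fun j ↦ ⟨le_rfl, le_pathEndZd _ _ _⟩, ?_⟩
      have h := le_pathEndZd (x + Pi.single i (1 : ℤ)) is i
      simpa using h
    · obtain ⟨h1, h2⟩ := ih he
      refine ⟨fun j ↦ ⟨le_trans ?_ (h1 j).1, (h1 j).2⟩, h2⟩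
      by_cases hj : j = i
      · subst hj; simp
      · simp [hj]

end Mon

/-- **Gauge covariance of transport** (telescoping): `U^g(Γ) = g(start) U(Γ) g(end)⁻¹` (Bałaban 1985,
p. 24: `U^u(Γ_{c,x}) = u(c₋) U(Γ_{c,x}) u(c₊)⁻¹`). [cite: Balaban1985Averaging, Sect. B p. 24 (property (11))] -/
theorem pathHolonomyZd_gaugeTransformZd [Group G] (g : Site d → G) (U : LGConfig d G) (x : Site d)
    (is : List (Fin d)) :
    pathHolonomyZd (gaugeTransformZd g U) x is = g x * pathHolonomyZd U x is * (g (pathEndZd x is))⁻¹ := by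
  induction is generalizing x with
  | nil => simp
  | cons i is ih =>
    rw [pathHolonomyZd_cons, pathHolonomyZd_cons, ih, pathEndZd_cons]
    simp only [gaugeTransformZd]
    group

/-- The coordinate-ordered **taxi word** of an offset `t ∈ ℕ^d`: `t₀` steps in direction `0`, then `t₁` steps in
direction `1`, … — the fixed contour `Γ_{y,x}` from the block corner `y` to `x = y + t` inside the block
(Bałaban 1984, (1.8); the torus file's `torusBlockPath`). [folklore] -/
def taxiWord (t : Fin d → ℕ) : List (Fin d) := (List.finRange d).flatMap fun i => List.replicate (t i) i

/-- Endpoint of a concatenation of straight segments in distinct directions.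
[cite: Balaban1984Propagators, §1 (1.8) (contours Γ_{y,x})] -/
theorem pathEndZd_flatMap_replicate (x : Site d) (t : Fin d → ℕ) (l : List (Fin d)) (hl : l.Nodup) :
    pathEndZd x (l.flatMap fun i => List.replicate (t i) i) = x + fun j => if j ∈ l then (t j : ℤ) else 0 := by
  induction l generalizing x with
  | nil => funext j; simp
  | cons i l ih =>
    rw [List.flatMap_cons, pathEndZd_append, pathEndZd_replicate, ih _ (List.nodup_cons.1 hl).2]
    funext j
    simp only [Pi.add_apply, List.mem_cons]
    by_cases hj : j = i
    · subst hj
      have : j ∉ l := (List.nodup_cons.1 hl).1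
      simp [this]
    · simp [hj]

/-- The taxi path of the offset `t` from `x` ends at `x + t`. [cite: Balaban1984Propagators, §1 (1.8) (contours Γ_{y,x})] -/
theorem pathEndZd_taxiWord (x : Site d) (t : Fin d → ℕ) : pathEndZd x (taxiWord t) = x + fun j => (t j : ℤ) := by
  rw [taxiWord, pathEndZd_flatMap_replicate x t _ (List.nodup_finRange d)]
  simp [List.mem_finRange]

end Path

/-! ### Dressed block transporters and the average -/

section Block

variable (L : ℕ)

/-- The offset vector in `ℤ^d` of `t ∈ {0, …, L-1}^d` (the sites of the block `B(y)` are `L y + t`, tree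
`blockSites`). [folklore] -/
def blockOffsetZd (t : Fin d → Fin L) : Site d := fun i => ((t i : ℕ) : ℤ)

variable [Group G]

/-- **The dressed transporter `U(Γ_{c,x})`** of the coarse bond `c = (y, μ)` through the block site
`x = L y + t` (Bałaban 1985, p. 19 and (42)): transport along the taxi path `c₋ = L y → x`, then the straight
segment `x → x + L e_μ = x(c)`, then back to `c₊ = L(y + e_μ)` along the reverse of the taxi path from `c₊` to
`x + L e_μ` (the same contour pattern started at the corner of the neighbouring block):
`U(Γ_{c₋,x}) · U([x, x(c)]) · U(Γ_{c₊, x(c)})⁻¹`. [cite: Balaban1985Averaging, Intro p. 19 (Γ_{c,x}) and Sect. B (42)] -/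
def dressedTransporterZd (U : LGConfig d G) (c : ZdEdge d) (t : Fin d → Fin L) : G :=
  pathHolonomyZd U (blockBase L c.1) (taxiWord fun i => (t i : ℕ)) *
    pathHolonomyZd U (blockBase L c.1 + blockOffsetZd L t) (List.replicate L c.2) *
      (pathHolonomyZd U (blockBase L (c.1 + Pi.single c.2 1)) (taxiWord fun i => (t i : ℕ)))⁻¹

variable {L}

/-- The taxi path from the corner `L y` reaches the block site `L y + t`. [cite: Balaban1985Averaging, Intro p. 19 (Γ_{c₋,x})] -/
theorem pathEndZd_blockBase_taxiWord (y : Site d) (t : Fin d → Fin L) :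
    pathEndZd (blockBase L y) (taxiWord fun i => (t i : ℕ)) = blockBase L y + blockOffsetZd L t :=
  pathEndZd_taxiWord _ _

/-- `c₊ = L (y + e_μ) = L y + L e_μ` (tree `blockBase_add_single`). [cite: Balaban1985Averaging, Intro p. 19 (c₊)] -/
theorem blockBase_add_single_one (y : Site d) (μ : Fin d) :
    blockBase L (y + Pi.single μ 1) = blockBase L y + Pi.single μ (L : ℤ) := by
  rw [blockBase_add_single, mul_one]

/-- The straight segment from `x = L y + t` ends at `x(c) = L(y + e_μ) + t`, the site of the neighbouring block
with the same offset. [cite: Balaban1985Averaging, Intro p. 19 ([x, x(c)])] -/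
theorem pathEndZd_segment (y : Site d) (μ : Fin d) (t : Fin d → Fin L) :
    pathEndZd (blockBase L y + blockOffsetZd L t) (List.replicate L μ) =
      blockBase L (y + Pi.single μ 1) + blockOffsetZd L t := by
  rw [pathEndZd_replicate, blockBase_add_single_one, add_right_comm]

variable (L)

/-- The dressed transporters of the trivial configuration are trivial. [cite: Balaban1985Averaging, Sect. B (42)] -/
theorem dressedTransporterZd_one (c : ZdEdge d) (t : Fin d → Fin L) :
    dressedTransporterZd L (1 : LGConfig d G) c t = 1 := by
  simp [dressedTransporterZd, pathHolonomyZd_one]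

/-- **Gauge covariance of the dressed transporters**: `U^g(Γ_{c,x}) = g(c₋) U(Γ_{c,x}) g(c₊)⁻¹` (Bałaban 1985,
p. 24, the displayed identity in the proof of (11)). [cite: Balaban1985Averaging, Sect. B p. 24 (property (11))] -/
theorem dressedTransporterZd_gaugeTransformZd (g : Site d → G) (U : LGConfig d G) (c : ZdEdge d)
    (t : Fin d → Fin L) :
    dressedTransporterZd L (gaugeTransformZd g U) c t =
      g (blockBase L c.1) * dressedTransporterZd L U c t * (g (blockBase L (c.1 + Pi.single c.2 1)))⁻¹ := by
  simp only [dressedTransporterZd, pathHolonomyZd_gaugeTransformZd, pathEndZd_blockBase_taxiWord,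
    pathEndZd_segment]
  group

variable {N : ℕ} (ρ : G →* Matrix (Fin N) (Fin N) ℂ)

/-- **Bałaban's one-step block averaging `Ū` on `ℤ^d`** (CMP 98 (1985), (15) = (42):
`Ū_c = exp[ ∑_{x ∈ B(c₋)} L^{-d} log( U(Γ_{c,x}) U(c)⁻¹ ) ] U(c)`), block factor `L`, in the representation
`ρ : G →* M_N(ℂ)`: on the coarse bond `c` (coarse lattice `L ℤ^d` identified with `ℤ^d` by `blockBase`, as in
`BalabanRG.lean`) the tree's `G`-valued mean `balabanGroupMean ρ` (file `BalabanBlockAverage.lean`: formula (42)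
on Bałaban's small-field branch, the reference otherwise) of the family of the `L^d` dressed transporters
`U(Γ_{c,x})`, `x ∈ B(c₋)`, relative to the straight transporter `U(c) = axialBlockHolonomy L U c`.
[cite: Balaban1985Averaging, Intro (15) and Sect. B (42)] -/
def balabanAverageZd (U : LGConfig d G) : LGConfig d G := fun c =>
  balabanGroupMean ρ (axialBlockHolonomy L U c) (dressedTransporterZd L U c)

/-- **The `k`-th order averaging `U ↦ U^k`** (Bałaban 1985, (43): *"if `k`-th order averaging `U^k` is
defined at bonds of `Ω^{(k)}`, then `U^{k+1}_c = exp[…log(U^k(Γ_{c,x}) U^k(c)⁻¹)] U^k(c)` where the contours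
`Γ_{c,x}` are defined on the lattice `Ω^{(k)}`"*): the `k`-fold iterate of the one-step averaging (each coarse
lattice re-identified with `ℤ^d`; the `k`-th coarse lattice is `L^k ℤ^d`, cf. `balabanAverageZdIter_gaugeTransformZd`,
`dependsOn_balabanAverageZdIter_apply`). [cite: Balaban1985Averaging, Sect. B (43)] -/
def balabanAverageZdIter (k : ℕ) : LGConfig d G → LGConfig d G := (balabanAverageZd L ρ)^[k]

variable {L ρ}

/-- Unfolding `balabanAverageZd` on a coarse bond. [cite: Balaban1985Averaging, Sect. B (42)] -/
theorem balabanAverageZd_apply (U : LGConfig d G) (c : ZdEdge d) :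
    balabanAverageZd L ρ U c = balabanGroupMean ρ (axialBlockHolonomy L U c) (dressedTransporterZd L U c) := rfl

/-- `U^0 = U`. [cite: Balaban1985Averaging, Sect. B (43)] -/
@[simp] theorem balabanAverageZdIter_zero : balabanAverageZdIter L ρ 0 = (id : LGConfig d G → _) := rfl

/-- (43): `U^{k+1}` is the one-step average of `U^k`. [cite: Balaban1985Averaging, Sect. B (43)] -/
theorem balabanAverageZdIter_succ (k : ℕ) (U : LGConfig d G) :
    balabanAverageZdIter L ρ (k + 1) U = balabanAverageZd L ρ (balabanAverageZdIter L ρ k U) :=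
  Function.iterate_succ_apply' _ _ _

/-- **The mean of a constant family is the reference** (faithful `ρ`): all fluctuations `Tᵢ S⁻¹ = 1`, `log 1 = 0`,
`exp 0 = 1`, so (42) gives `S` (on Bałaban's branch, which is taken). Complements the torus file's
`balabanGroupMean_one`. [cite: Balaban1985Averaging, Sect. B (42)] -/
theorem balabanGroupMean_const {ι : Type*} [Fintype ι] (hinj : Function.Injective ρ) (S : G) :
    balabanGroupMean ρ S (fun _ : ι => S) = S := by
  have hsmall : IsSmallFamily ρ S (fun _ : ι => S) := fun i => by
    norm_num [IsSmallFamily, mul_inv_cancel, map_one]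
  have hmean : balabanMatrixMean ρ S (fun _ : ι => S) = ρ S := by
    simp [balabanMatrixMean]
  have h : IsSmallFamily ρ S (fun _ : ι => S) ∧ balabanMatrixMean ρ S (fun _ : ι => S) ∈ Set.range ρ :=
    ⟨hsmall, ⟨S, hmean.symm⟩⟩
  rw [balabanGroupMean, if_pos h, hmean]
  exact Function.leftInverse_invFun hinj S

/-- **Reduction to the axial block holonomy**: if every dressed transporter `U(Γ_{c,x})`, `x ∈ B(c₋)`, equals the
straight one `U(c)` (e.g. `U` trivial on the taxi paths and translation invariant along the block), then
`Ū(c) = U(c) = axialBlockHolonomy L U c` — the tree's `BalabanRG` block variable is the degenerate case of (42)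
(Bałaban 1984, (1.4)–(1.6): in the axial gauge the average is the straight transport).
[cite: Balaban1985Averaging, Sect. B (42)] [cite: Balaban1984Propagators, §1 (1.4)–(1.6)] -/
theorem balabanAverageZd_apply_eq_axialBlockHolonomy (hinj : Function.Injective ρ) {U : LGConfig d G}
    {c : ZdEdge d} (h : ∀ t, dressedTransporterZd L U c t = axialBlockHolonomy L U c) :
    balabanAverageZd L ρ U c = axialBlockHolonomy L U c := by
  rw [balabanAverageZd_apply, show dressedTransporterZd L U c = fun _ => axialBlockHolonomy L U c from funext h]
  exact balabanGroupMean_const hinj _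

/-- `Ū(1) = 1` (faithful `ρ`). [cite: Balaban1985Averaging, Sect. B (42)] -/
theorem balabanAverageZd_one (hinj : Function.Injective ρ) :
    balabanAverageZd L ρ (1 : LGConfig d G) = 1 := by
  funext c
  rw [balabanAverageZd_apply_eq_axialBlockHolonomy hinj (fun t => by
    rw [dressedTransporterZd_one, axialBlockHolonomy_one]; rfl), axialBlockHolonomy_one]

/-- `1^k = 1` for the iterated averaging. [cite: Balaban1985Averaging, Sect. B (43)] -/
theorem balabanAverageZdIter_one (hinj : Function.Injective ρ) (k : ℕ) :
    balabanAverageZdIter L ρ k (1 : LGConfig d G) = 1 := by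
  induction k with
  | zero => rfl
  | succ k ih => rw [balabanAverageZdIter_succ, ih, balabanAverageZd_one hinj]

/-- **(11) Gauge covariance of `Ū`** (Bałaban 1985, p. 24: *"from (42) we get `(Ū^u)_c = u(c₋) Ū_c u⁻¹(c₊)`"*),
in the tree's form: a fine gauge transformation `g` acts on the block variables as the coarse gauge
transformation `g ∘ blockBase L` (same law as `axialBlockHolonomy_gaugeTransformZd`); for `ρ` unitary and
faithful, on both branches of the total mean (`balabanGroupMean_conj`).
[cite: Balaban1985Averaging, Intro (11) and Sect. B p. 24] -/
theorem balabanAverageZd_gaugeTransformZd (hρu : ∀ g, ρ g ∈ Matrix.unitaryGroup (Fin N) ℂ)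
    (hinj : Function.Injective ρ) (g : Site d → G) (U : LGConfig d G) :
    balabanAverageZd L ρ (gaugeTransformZd g U) = gaugeTransformZd (g ∘ blockBase L) (balabanAverageZd L ρ U) := by
  funext c
  rw [balabanAverageZd_apply, show dressedTransporterZd L (gaugeTransformZd g U) c = fun t =>
      g (blockBase L c.1) * dressedTransporterZd L U c t * (g (blockBase L (c.1 + Pi.single c.2 1)))⁻¹ from
    funext (dressedTransporterZd_gaugeTransformZd L g U c), axialBlockHolonomy_gaugeTransformZd]
  exact balabanGroupMean_conj ρ hρu hinj _ _ _ _

/-- Corners of corners: `M (M' y) = (M M') y` (the `k`-th coarse lattice of (43) is `L^k ℤ^d`).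
[cite: Balaban1985Averaging, Sect. B (43) (lattices Ω^{(k)})] -/
theorem blockBase_blockBase (M M' : ℕ) (y : Site d) : blockBase M (blockBase M' y) = blockBase (M * M') y := by
  funext i; simp [blockBase, mul_assoc]

/-- **Gauge covariance of the `k`-th order averaging**: `(U^g)^k = (U^k)^{g ∘ blockBase (L^k)}` ((11) iterated
along (43)). [cite: Balaban1985Averaging, Intro (11) and Sect. B (43)] -/
theorem balabanAverageZdIter_gaugeTransformZd (hρu : ∀ g, ρ g ∈ Matrix.unitaryGroup (Fin N) ℂ)
    (hinj : Function.Injective ρ) (k : ℕ) (g : Site d → G) (U : LGConfig d G) :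
    balabanAverageZdIter L ρ k (gaugeTransformZd g U) =
      gaugeTransformZd (g ∘ blockBase (L ^ k)) (balabanAverageZdIter L ρ k U) := by
  induction k with
  | zero => simp [Function.comp_def]
  | succ k ih =>
    rw [balabanAverageZdIter_succ, balabanAverageZdIter_succ, ih, balabanAverageZd_gaugeTransformZd hρu hinj]
    congr 1
    funext y
    simp only [Function.comp_apply, blockBase_blockBase, pow_succ]

end Block

/-! ### Measurability -/

section Measurable

variable [Group G] [MeasurableSpace G]

/-- Transport along a fixed path is a measurable function of the configuration (finitely many multiplications
of coordinate projections; product σ-algebra on `LGConfig d G`). [cite: Balaban1985Averaging, Intro (10) (the averaging under the integral dU)] -/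
theorem measurable_pathHolonomyZd [MeasurableMul₂ G] (x : Site d) (is : List (Fin d)) :
    Measurable fun U : LGConfig d G => pathHolonomyZd U x is := by
  induction is generalizing x with
  | nil => exact measurable_const
  | cons i is ih => exact (measurable_pi_apply (x, i)).mul (ih _)

variable (L : ℕ)

/-- The axial block holonomy on a fixed coarse bond is measurable. [cite: Balaban1984Propagators, §1 (1.4)–(1.6)] -/
theorem measurable_axialBlockHolonomy_apply [MeasurableMul₂ G] (c : ZdEdge d) :
    Measurable fun U : LGConfig d G => axialBlockHolonomy L U c := by
  simpa only [pathHolonomyZd_replicate_blockBase] using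
    measurable_pathHolonomyZd (G := G) (blockBase L c.1) (List.replicate L c.2)

/-- Each dressed transporter is a measurable function of the configuration. [cite: Balaban1985Averaging, Sect. B (42)] -/
theorem measurable_dressedTransporterZd [MeasurableMul₂ G] [MeasurableInv G] (c : ZdEdge d) (t : Fin d → Fin L) :
    Measurable fun U : LGConfig d G => dressedTransporterZd L U c t :=
  ((measurable_pathHolonomyZd _ _).mul (measurable_pathHolonomyZd _ _)).mul (measurable_pathHolonomyZd _ _).inv

variable {N : ℕ} (ρ : G →* Matrix (Fin N) (Fin N) ℂ) [TopologicalSpace G] [IsTopologicalGroup G] [CompactSpace G]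
  [BorelSpace G]

/-- Each coarse link of `Ū` is a measurable function of `U` (the joint measurability of the `G`-valued mean,
`measurable_balabanGroupMean`, composed with the measurable pair (reference, family)).
[cite: Balaban1985Averaging, Intro (10) and Sect. B (42)] -/
theorem measurable_balabanAverageZd_apply [MeasurableMul₂ G] [MeasurableInv G] (hρc : Continuous ρ)
    (hinj : Function.Injective ρ) (c : ZdEdge d) :
    Measurable fun U : LGConfig d G => balabanAverageZd L ρ U c := by
  have hm : Measurable fun p : G × ((Fin d → Fin L) → G) => balabanGroupMean ρ p.1 p.2 :=
    measurable_balabanGroupMean ρ hρc hinj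
  have hT : Measurable fun U : LGConfig d G => fun t : Fin d → Fin L => dressedTransporterZd L U c t :=
    measurable_pi_lambda _ fun t => measurable_dressedTransporterZd L c t
  have hf : Measurable fun U : LGConfig d G =>
      (axialBlockHolonomy L U c, fun t : Fin d → Fin L => dressedTransporterZd L U c t) :=
    (measurable_axialBlockHolonomy_apply L c).prodMk hT
  have h := hm.comp hf
  exact (show (fun U : LGConfig d G => balabanAverageZd L ρ U c) =
    ((fun p : G × ((Fin d → Fin L) → G) => balabanGroupMean ρ p.1 p.2) ∘ fun U : LGConfig d G =>
      (axialBlockHolonomy L U c, fun t : Fin d → Fin L => dressedTransporterZd L U c t)) from rfl) ▸ h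

/-- **Measurability of `U ↦ Ū`** for the product Borel structures on `LGConfig d G` (compact `G`, continuous
faithful `ρ`; the averaging enters Bałaban's renormalization transformation (10) under the integral `∫ dU`).
[cite: Balaban1985Averaging, Intro (10) and Sect. B (42)] -/
theorem measurable_balabanAverageZd (hρc : Continuous ρ) (hinj : Function.Injective ρ) :
    Measurable (balabanAverageZd L ρ : LGConfig d G → LGConfig d G) := by
  haveI : SecondCountableTopology G := (hρc.isClosedEmbedding hinj).isEmbedding.secondCountableTopology
  haveI : MeasurableMul₂ G := ContinuousMul.measurableMul₂
  haveI : MeasurableInv G := ContinuousInv.measurableInv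
  exact measurable_pi_lambda _ fun c => measurable_balabanAverageZd_apply L ρ hρc hinj c

/-- Measurability of the `k`-th order averaging. [cite: Balaban1985Averaging, Sect. B (43)] -/
theorem measurable_balabanAverageZdIter (hρc : Continuous ρ) (hinj : Function.Injective ρ) (k : ℕ) :
    Measurable (balabanAverageZdIter L ρ k : LGConfig d G → LGConfig d G) :=
  (measurable_balabanAverageZd L ρ hρc hinj).iterate k

end Measurable

/-! ### Locality -/

section Locality

variable (L : ℕ)

/-- **The bonds `b ⊂ B(c₋) ∪ B(c₊)`** of the double block of the coarse bond `c = (y, μ)` (Bałaban 1985, p. 24):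
the fine bonds BOTH of whose endpoints lie in the block `y` or in the block `y + e_μ` (blocks of side `L`,
tree `blockMap`). [cite: Balaban1985Averaging, Sect. B p. 24 (locality)] -/
def doubleBlockBonds (c : ZdEdge d) : Set (ZdEdge d) :=
  {e | (blockMap L e.1 = c.1 ∨ blockMap L e.1 = c.1 + Pi.single c.2 1) ∧
       (blockMap L (e.1 + Pi.single e.2 1) = c.1 ∨ blockMap L (e.1 + Pi.single e.2 1) = c.1 + Pi.single c.2 1)}

variable {L}

/-- Membership in `doubleBlockBonds` (definitional). [cite: Balaban1985Averaging, Sect. B p. 24 (locality)] -/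
theorem mem_doubleBlockBonds_iff {c e : ZdEdge d} : e ∈ doubleBlockBonds L c ↔
    (blockMap L e.1 = c.1 ∨ blockMap L e.1 = c.1 + Pi.single c.2 1) ∧
      (blockMap L (e.1 + Pi.single e.2 1) = c.1 ∨ blockMap L (e.1 + Pi.single e.2 1) = c.1 + Pi.single c.2 1) :=
  Iff.rfl

/-- With block side `1` every bond lies in its own double block (the case `k = 0` of the iterated locality).
[cite: Balaban1985Averaging, Sect. B p. 24 (locality)] -/
theorem self_mem_doubleBlockBonds_one (c : ZdEdge d) : c ∈ doubleBlockBonds 1 c := by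
  simp [mem_doubleBlockBonds_iff]

/-- Sites `L y + w` with `0 ≤ wᵢ < L` (`i ≠ μ`) and `0 ≤ w_μ < 2L` lie in the block `y` or in the block
`y + e_μ`. [cite: Balaban1985Averaging, Sect. B p. 24 (B(c₋) ∪ B(c₊))] -/
theorem blockMap_blockBase_add_of_lt_two_mul (y : Site d) (μ : Fin d) (w : Site d) (h0 : ∀ i, 0 ≤ w i)
    (hlt : ∀ i, i ≠ μ → w i < L) (hμ : w μ < 2 * L) :
    blockMap L (blockBase L y + w) = y ∨ blockMap L (blockBase L y + w) = y + Pi.single μ 1 := by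
  by_cases h : w μ < L
  · exact Or.inl (blockMap_blockBase_add_of_lt L y w h0 fun i => if hi : i = μ then hi ▸ h else hlt i hi)
  · right
    have hw : blockBase L y + w = blockBase L (y + Pi.single μ 1) + (w - Pi.single μ (L : ℤ)) := by
      rw [blockBase_add_single_one]; abel
    rw [hw]
    refine blockMap_blockBase_add_of_lt L _ _ (fun i => ?_) (fun i => ?_)
    · by_cases hi : i = μ
      · subst hi; simp only [Pi.sub_apply, Pi.single_eq_same]; omega
      · simp [hi, h0 i]
    · by_cases hi : i = μ
      · subst hi; simp only [Pi.sub_apply, Pi.single_eq_same]; omega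
      · simpa [hi] using hlt i hi

/-- The bonds of the taxi path `Γ_{Ly, Ly+t}`, `t ∈ {0,…,L-1}^d`, lie INSIDE the block `y` (both endpoints).
[cite: Balaban1985Averaging, Sect. B p. 24 (locality)] -/
theorem blockMap_eq_of_mem_pathEdgesZd_taxiWord {y : Site d} {t : Fin d → Fin L} {e : ZdEdge d}
    (he : e ∈ pathEdgesZd (blockBase L y) (taxiWord fun i => (t i : ℕ))) :
    blockMap L e.1 = y ∧ blockMap L (e.1 + Pi.single e.2 1) = y := by
  obtain ⟨hb, hs⟩ := bounds_of_mem_pathEdgesZd he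
  rw [pathEndZd_taxiWord] at hb hs
  have key : ∀ (w : Site d), (∀ j, blockBase L y j ≤ w j ∧ w j ≤ blockBase L y j + (t j : ℕ)) → blockMap L w = y := by
    intro w hw
    have : w = blockBase L y + (w - blockBase L y) := by abel
    rw [this]
    refine blockMap_blockBase_add_of_lt L y _ (fun j => ?_) (fun j => ?_)
    · simp only [Pi.sub_apply]; linarith [(hw j).1]
    · simp only [Pi.sub_apply]; have := (hw j).2; have := (t j).2; omega
  refine ⟨key e.1 fun j => ⟨(hb j).1, by simpa using (hb j).2⟩, key _ fun j => ⟨?_, ?_⟩⟩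
  · by_cases hj : j = e.2
    · subst hj; simp only [Pi.add_apply, Pi.single_eq_same]; linarith [(hb e.2).1]
    · simp only [Pi.add_apply, Pi.single_eq_of_ne hj, add_zero]; exact (hb j).1
  · by_cases hj : j = e.2
    · subst hj; simpa only [Pi.add_apply, Pi.single_eq_same] using hs
    · simp only [Pi.add_apply, Pi.single_eq_of_ne hj, add_zero]; simpa using (hb j).2

/-- The bonds of the straight segment `[x, x + L e_μ]` from a site `x = L y + w` of the block `y` lie inside the
double block `B(y) ∪ B(y + e_μ)`. [cite: Balaban1985Averaging, Sect. B p. 24 (locality)] -/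
theorem mem_doubleBlockBonds_of_mem_pathEdgesZd_replicate {y : Site d} {μ : Fin d} {w : Site d}
    (h0 : ∀ i, 0 ≤ w i) (hlt : ∀ i, w i < L) {e : ZdEdge d}
    (he : e ∈ pathEdgesZd (blockBase L y + w) (List.replicate L μ)) : e ∈ doubleBlockBonds L (y, μ) := by
  obtain ⟨hb, hs⟩ := bounds_of_mem_pathEdgesZd he
  rw [pathEndZd_replicate] at hb hs
  have key : ∀ (z : Site d), (∀ j, blockBase L y j + w j ≤ z j ∧ z j ≤ blockBase L y j + w j + (Pi.single μ (L : ℤ) : Site d) j) →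
      blockMap L z = y ∨ blockMap L z = y + Pi.single μ 1 := by
    intro z hz
    have : z = blockBase L y + (z - blockBase L y) := by abel
    rw [this]
    refine blockMap_blockBase_add_of_lt_two_mul y μ _ (fun j => ?_) (fun j hj => ?_) ?_
    · simp only [Pi.sub_apply]; linarith [(hz j).1, h0 j]
    · simp only [Pi.sub_apply]; have := (hz j).2; rw [Pi.single_eq_of_ne hj] at this; linarith [hlt j]
    · simp only [Pi.sub_apply]; have := (hz μ).2; rw [Pi.single_eq_same] at this; linarith [hlt μ]
  refine ⟨key e.1 fun j => ⟨by simpa using (hb j).1, by simpa using (hb j).2⟩, key _ fun j => ⟨?_, ?_⟩⟩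
  · by_cases hj : j = e.2
    · subst hj
      have h1 := (hb e.2).1
      simp only [Pi.add_apply, Pi.single_eq_same] at h1 ⊢
      linarith
    · simp only [Pi.add_apply, Pi.single_eq_of_ne hj, add_zero]; simpa using (hb j).1
  · by_cases hj : j = e.2
    · subst hj; simpa only [Pi.add_apply, Pi.single_eq_same] using hs
    · simp only [Pi.add_apply, Pi.single_eq_of_ne hj, add_zero]; simpa using (hb j).2

variable (L)

variable [Group G]

/-- **Locality of the dressed transporters**: `U(Γ_{c,x})` depends only on the bonds inside `B(c₋) ∪ B(c₊)`.
[cite: Balaban1985Averaging, Sect. B p. 24 (locality)] -/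
theorem dependsOn_dressedTransporterZd (c : ZdEdge d) (t : Fin d → Fin L) :
    DependsOn (fun U : LGConfig d G => dressedTransporterZd L U c t) (doubleBlockBonds L c) := by
  intro U V h
  obtain ⟨y, μ⟩ := c
  simp only [dressedTransporterZd]
  have h1 : pathHolonomyZd U (blockBase L y) (taxiWord fun i => (t i : ℕ)) =
      pathHolonomyZd V (blockBase L y) (taxiWord fun i => (t i : ℕ)) :=
    pathHolonomyZd_congr _ _ fun e he => h e (by
      obtain ⟨ha, hb⟩ := blockMap_eq_of_mem_pathEdgesZd_taxiWord he
      exact ⟨Or.inl ha, Or.inl hb⟩)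
  have h2 : pathHolonomyZd U (blockBase L y + blockOffsetZd L t) (List.replicate L μ) =
      pathHolonomyZd V (blockBase L y + blockOffsetZd L t) (List.replicate L μ) :=
    pathHolonomyZd_congr _ _ fun e he => h e
      (mem_doubleBlockBonds_of_mem_pathEdgesZd_replicate (fun i => by simp [blockOffsetZd])
        (fun i => by simp [blockOffsetZd]) he)
  have h3 : pathHolonomyZd U (blockBase L (y + Pi.single μ 1)) (taxiWord fun i => (t i : ℕ)) =
      pathHolonomyZd V (blockBase L (y + Pi.single μ 1)) (taxiWord fun i => (t i : ℕ)) :=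
    pathHolonomyZd_congr _ _ fun e he => h e (by
      obtain ⟨ha, hb⟩ := blockMap_eq_of_mem_pathEdgesZd_taxiWord he
      exact ⟨Or.inr ha, Or.inr hb⟩)
  rw [h1, h2, h3]

/-- Locality of the straight transporter `U(c)` in the same form (`L ≠ 0`).
[cite: Balaban1985Averaging, Sect. B p. 24 (locality)] -/
theorem dependsOn_axialBlockHolonomy_apply [NeZero L] (c : ZdEdge d) :
    DependsOn (fun U : LGConfig d G => axialBlockHolonomy L U c) (doubleBlockBonds L c) := by
  intro U V h
  obtain ⟨y, μ⟩ := c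
  simp only [← pathHolonomyZd_replicate_blockBase]
  have hL : 0 < L := Nat.pos_of_ne_zero (NeZero.ne L)
  refine pathHolonomyZd_congr _ _ fun e he => h e ?_
  have he' : e ∈ pathEdgesZd (blockBase L y + 0) (List.replicate L μ) := by rwa [add_zero]
  exact mem_doubleBlockBonds_of_mem_pathEdgesZd_replicate (w := 0) (fun _ => le_rfl)
    (fun _ => by rw [Pi.zero_apply]; exact_mod_cast hL) he'

variable {N : ℕ} (ρ : G →* Matrix (Fin N) (Fin N) ℂ)

/-- **Locality of `Ū`** (Bałaban 1985, p. 24: *"`Ū_c` depends only on the bond variables `U_b` for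
`b ⊂ B(c₋) ∪ B(c₊)`"*): the coarse link `Ū(c)` is a function of the fine links with both endpoints in the double
block of `c` (Mathlib `DependsOn`; `L ≠ 0`). [cite: Balaban1985Averaging, Sect. B p. 24 (locality)] -/
theorem dependsOn_balabanAverageZd_apply [NeZero L] (c : ZdEdge d) :
    DependsOn (fun U : LGConfig d G => balabanAverageZd L ρ U c) (doubleBlockBonds L c) := by
  intro U V h
  have ha : axialBlockHolonomy L U c = axialBlockHolonomy L V c := dependsOn_axialBlockHolonomy_apply L c h
  have hd : dressedTransporterZd L U c = dressedTransporterZd L V c :=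
    funext fun t => dependsOn_dressedTransporterZd L c t h
  simp only [balabanAverageZd_apply, ha, hd]

/-- Blocks of blocks: `⌊⌊x/M⌋/M'⌋ = ⌊x/(M M')⌋` coordinatewise (floor division), i.e. the `M'`-blocks of the
`M`-block lattice are the `M M'`-blocks (the lattices `Ω^{(k)}` of (43) have blocks of side `L^k`).
[cite: Balaban1985Averaging, Sect. B (43) (blocks B^k)] -/
theorem blockMap_blockMap (M M' : ℕ) (x : Site d) : blockMap M' (blockMap M x) = blockMap (M * M') x := by
  funext i
  simp only [blockMap, Nat.cast_mul]
  exact Int.ediv_ediv_of_nonneg (by positivity)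

/-- **Locality of the `k`-th order averaging** (Bałaban 1985, p. 24: *"`U^k_c`, `c ⊂ Ω^{(k)}`, depends only on
the bond variables `U_b` for `b ⊂ B^k(c₋) ∪ B^k(c₊)`"*): `U^k(c)` is a function of the fine links with both
endpoints in the blocks of side `L^k` labelled `c₋`, `c₊` — by induction on `k` from the one-step locality,
since a bond inside the double `L`-block of a bond inside the double `L^k`-block … lies inside the double
`L^{k+1}`-block (`blockMap_blockMap`). [cite: Balaban1985Averaging, Sect. B p. 24 (locality of U^k)] -/
theorem dependsOn_balabanAverageZdIter_apply [NeZero L] (k : ℕ) (c : ZdEdge d) :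
    DependsOn (fun U : LGConfig d G => balabanAverageZdIter L ρ k U c) (doubleBlockBonds (L ^ k) c) := by
  induction k generalizing c with
  | zero => exact fun U V h => h c (by simpa using self_mem_doubleBlockBonds_one c)
  | succ k ih =>
    intro U V h
    simp only [balabanAverageZdIter_succ]
    refine dependsOn_balabanAverageZd_apply L ρ c (x := balabanAverageZdIter L ρ k U)
      (y := balabanAverageZdIter L ρ k V) fun b hb => ih b fun e he => h e ?_
    rw [mem_doubleBlockBonds_iff] at hb he ⊢
    rw [pow_succ, ← blockMap_blockMap, ← blockMap_blockMap]
    constructor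
    · rcases he.1 with h1 | h1 <;> rw [h1]
      · exact hb.1
      · exact hb.2
    · rcases he.2 with h1 | h1 <;> rw [h1]
      · exact hb.1
      · exact hb.2

end Locality

end Literature.MathematicalPhysics.QuantumLattice
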